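import Mathlib
import Summits.Ventures.HodgeRepro2.T5RecordLatticeModelOutsideDiscriminant
import Summits.Ventures.HodgeRepro2.T5DeltaTwistTensor

/-!
# THE LATTICE OF THE DUAL PAIR `V ⊗ W`: `𝒪_w^{ι × κ}` IS `ψ_w`-SELF-DUAL FOR THE KRONECKER GRAM MATRIX `H ⊗ₖ S`

Tier-5 support N3 / §G-N4.2 (seat p3, gen 85). The lattice model of the Weil representation of the dual pair
`(U(V), U(W))` (MVW Chapter 5, the standing hypothesis «`L_i ⊂ W_i` autodual», §N3.10.3 (u3)/(u4)) lives on the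
SYMPLECTIC space `V ⊗_E W` (the `F`-form `Tr_{E/F}(⟨·,·⟩_V ⊗ ⟨·,·⟩_W)`) and its lattice `L_V ⊗ L_W`. Writing
`V = E^ι` with Gram matrix `H` and `W = E^κ` with Gram matrix `S` (hermitian or skew-hermitian), the tensor
product in the basis `e_i ⊗ f_j` is `E^{ι × κ}` with the KRONECKER Gram matrix `H ⊗ₖ S`, and self-duality of
`L_V ⊗ L_W = 𝒪_w^{ι × κ}` for the character `ψ_w = ψ ∘ Tr` of the symplectic form is exactly the `ψ_w`-self-duality
of `𝒪_w^{ι × κ}` for `H ⊗ₖ S` in the sense of files 329–331 (file 90 `T5DeltaTwistTensor` carries the symplectic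
form itself: `traceGram (H ⊗ₖ S) z z' = gram z z' + star (gram z z')` with `gram M x y = star x ⬝ᵥ (M *ᵥ y) =
sesqForm Mᵀ y x`, alternating for `H` hermitian and `S` skew-hermitian — `traceGram_self`; its `isUnit_kronecker`
is reused here). This file puts the LATTICE in the kernel:

* **`isUnit_det_kronecker`** — `det (H ⊗ₖ S) = det H ^ |κ| · det S ^ |ι|` is a unit when both are;
  **`notMem_badSet_kronecker`** / **`badSet_kronecker_subset`** — a place good for `H` and for `S` is good for
  `H ⊗ₖ S` (`(H ⊗ₖ S)⁻¹ = H⁻¹ ⊗ₖ S⁻¹`, entries are products);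
* **`dualLattice_stdLattice_kronecker_eq`** — the form-dual of `𝒪_w^{ι × κ}` for `H ⊗ₖ S` is itself at every
  such place; **`forall_addChar_kronecker_iff_mem_stdLattice`** — and so is its `ψ`-dual for every continuous
  non-trivial `ψ` of conductor exponent `0`;
* **`forall_recordChar_kronecker_iff_mem_stdLattice`** — THE RECORD: for integral unimodular `M_V`, `M_W` over
  `𝓞_K` (`K` any number field, the CM field of the lane), every place `v` of `K⁺` with `disc K ∉ v`, every `w ∣ v`
  and every star preserving integrality, `𝒪_w^{ι × κ}` is `ψ_w`-self-dual for the Kronecker Gram matrix — the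
  lattice `L_V ⊗ L_W` of the dual pair is self-dual at every place outside `disc K`.

Nothing here is a statement about (P), theta lifts or L-values. §8(d): uses an L-value-free non-vanishing
device: NO.
-/

open IsDedekindDomain IsDedekindDomain.HeightOneSpectrum NumberField Matrix
open scoped Kronecker
open Summit.Ventures.HodgeRepro2.T5AdditiveConductor Summit.Ventures.HodgeRepro2.T5UnitaryGroupIsometry
  Summit.Ventures.HodgeRepro2.T5ConductorDualBall Summit.Ventures.HodgeRepro2.T5ConductorDualLattice
  Summit.Ventures.HodgeRepro2.T5GlobalLatticeAlmostAll Summit.Ventures.HodgeRepro2.T5IntegralGramBadSet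
  Summit.Ventures.HodgeRepro2.T5ConductorZeroCharacter

namespace Summit.Ventures.HodgeRepro2.T5DualPairLatticeKronecker

section Kronecker

variable {L : Type*} [Field L] [NumberField L] {ι κ : Type*} [Fintype ι] [DecidableEq ι] [Fintype κ]
  [DecidableEq κ]

omit [Fintype ι] [DecidableEq ι] [Fintype κ] [DecidableEq κ] in
/-- A ring homomorphism commutes with the Kronecker product. -/
theorem map_kronecker {R R' : Type*} [CommRing R] [CommRing R'] (f : R →+* R') (A : Matrix ι ι R)
    (B : Matrix κ κ R) : (A ⊗ₖ B).map f = A.map f ⊗ₖ B.map f := by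
  ext ⟨i₁, i₂⟩ ⟨j₁, j₂⟩
  simp [kroneckerMap_apply, Matrix.map_apply, map_mul]

omit [NumberField L] in
/-- **`det (H ⊗ₖ S)` is a unit when `det H` and `det S` are** (file 90's `isUnit_kronecker`, `det_kronecker`). -/
theorem isUnit_det_kronecker {H : Matrix ι ι L} {S : Matrix κ κ L} (hH : IsUnit H.det) (hS : IsUnit S.det) :
    IsUnit (H ⊗ₖ S).det :=
  (Matrix.isUnit_iff_isUnit_det _).1 (T5DeltaTwistTensor.isUnit_kronecker hH hS)

/-- **A place good for `H` and for `S` is good for `H ⊗ₖ S`**: the entries of `H ⊗ₖ S` are the products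
`H i₁ j₁ * S i₂ j₂`, and `(H ⊗ₖ S)⁻¹ = H⁻¹ ⊗ₖ S⁻¹` (`inv_kronecker`). -/
theorem notMem_badSet_kronecker {H : Matrix ι ι L} {S : Matrix κ κ L} {w : HeightOneSpectrum (𝓞 L)}
    (hH : w ∉ badSet H) (hS : w ∉ badSet S) : w ∉ badSet (H ⊗ₖ S) := by
  rintro ⟨⟨i₁, i₂⟩, ⟨j₁, j₂⟩, h | h⟩
  · apply h
    rw [kroneckerMap_apply, map_mul]
    exact IsLocalization.isInteger_mul (isInteger_of_notMem_badSet hH i₁ j₁) (isInteger_of_notMem_badSet hS i₂ j₂)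
  · apply h
    rw [inv_kronecker, kroneckerMap_apply, map_mul]
    exact IsLocalization.isInteger_mul (isInteger_inv_of_notMem_badSet hH i₁ j₁)
      (isInteger_inv_of_notMem_badSet hS i₂ j₂)

/-- `badSet (H ⊗ₖ S) ⊆ badSet H ∪ badSet S`. -/
theorem badSet_kronecker_subset (H : Matrix ι ι L) (S : Matrix κ κ L) :
    badSet (H ⊗ₖ S) ⊆ badSet H ∪ badSet S := by
  intro w hw
  by_contra h
  rw [Set.mem_union, not_or] at h
  exact notMem_badSet_kronecker h.1 h.2 hw

/-- The bad set of `H ⊗ₖ S` is finite (it is anyway: `badSet_finite`). -/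
theorem badSet_kronecker_finite (H : Matrix ι ι L) (S : Matrix κ κ L) : (badSet (H ⊗ₖ S)).Finite :=
  badSet_finite _

/-- **THE FORM-DUAL OF `𝒪_w^{ι × κ}` FOR `H ⊗ₖ S` IS ITSELF** at every place good for `H` and for `S`, for any star
on `L_w` preserving integrality (file `T5GlobalLatticeAlmostAll`). -/
theorem dualLattice_stdLattice_kronecker_eq (w : HeightOneSpectrum (𝓞 L)) [StarRing (w.adicCompletion L)]
    (hstar : ∀ x : w.adicCompletion L, IsLocalization.IsInteger (w.adicCompletionIntegers L) x →
      IsLocalization.IsInteger (w.adicCompletionIntegers L) (star x))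
    {H : Matrix ι ι L} {S : Matrix κ κ L} (hH : IsUnit H.det) (hS : IsUnit S.det) (hwH : w ∉ badSet H)
    (hwS : w ∉ badSet S) :
    dualLattice (w.adicCompletionIntegers L) ((H ⊗ₖ S).map (algebraMap L (w.adicCompletion L)))
        (stdLattice (w.adicCompletionIntegers L)) =
      stdLattice (w.adicCompletionIntegers L) :=
  dualLattice_stdLattice_eq_of_notMem_badSet w hstar (isUnit_det_kronecker hH hS) (notMem_badSet_kronecker hwH hwS)

/-- **`𝒪_w^{ι × κ}` IS `ψ`-SELF-DUAL FOR `H ⊗ₖ S`** at every place good for `H` and for `S`, for every continuous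
non-trivial `ψ : L_w → S¹` of conductor exponent `0` and any star preserving integrality (file 329). -/
theorem forall_addChar_kronecker_iff_mem_stdLattice (w : HeightOneSpectrum (𝓞 L))
    [StarRing (w.adicCompletion L)] (ψ : AddChar (w.adicCompletion L) Circle) (hψ : Continuous ψ)
    (hne : ∃ y, ψ y ≠ 1)
    (h0 : conductorExp ψ (Valued.v : Valuation (w.adicCompletion L) (WithZero (Multiplicative ℤ))) = 0)
    (hstar : ∀ x : w.adicCompletion L, IsLocalization.IsInteger (w.adicCompletionIntegers L) x →
      IsLocalization.IsInteger (w.adicCompletionIntegers L) (star x))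
    {H : Matrix ι ι L} {S : Matrix κ κ L} (hH : IsUnit H.det) (hS : IsUnit S.det) (hwH : w ∉ badSet H)
    (hwS : w ∉ badSet S) (x : ι × κ → w.adicCompletion L) :
    (∀ y ∈ stdLattice (w.adicCompletionIntegers L),
      ψ (sesqForm ((H ⊗ₖ S).map (algebraMap L (w.adicCompletion L))) x y) = 1) ↔
      x ∈ stdLattice (w.adicCompletionIntegers L) :=
  forall_addChar_iff_mem_stdLattice_of_notMem_badSet w ψ hψ hne h0 hstar (isUnit_det_kronecker hH hS)
    (notMem_badSet_kronecker hwH hwS) x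

end Kronecker

section Record

variable (K : Type*) [Field K] [NumberField K]
variable {ι κ : Type*} [Fintype ι] [DecidableEq ι] [Fintype κ] [DecidableEq κ]
variable (MV : Matrix ι ι (𝓞 K)) (hV : IsUnit MV.det) (MW : Matrix κ κ (𝓞 K)) (hW : IsUnit MW.det)

include hV hW in
/-- **The Kronecker product of two integral unimodular Gram matrices is good at every finite place.** -/
theorem notMem_badSet_mapMatrix_kronecker (w : HeightOneSpectrum (𝓞 K)) :
    w ∉ badSet ((algebraMap (𝓞 K) K).mapMatrix MV ⊗ₖ (algebraMap (𝓞 K) K).mapMatrix MW) :=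
  notMem_badSet_kronecker (notMem_badSet_mapMatrix MV hV w) (notMem_badSet_mapMatrix MW hW w)

variable (vp : HeightOneSpectrum (𝓞 ℚ)) (v : HeightOneSpectrum (𝓞 (maximalRealSubfield K)))
  [v.asIdeal.LiesOver vp.asIdeal] (w : HeightOneSpectrum (𝓞 K)) [w.asIdeal.LiesOver v.asIdeal]

include hV hW in
/-- **THE LATTICE `L_V ⊗ L_W` OF THE DUAL PAIR IS `ψ_w`-SELF-DUAL AT EVERY PLACE OUTSIDE `disc K`**: for integral
unimodular Gram matrices `M_V`, `M_W` over `𝓞_K`, every place `v` of `K⁺` with `disc K ∉ v` above `v_p`, every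
continuous non-trivial `ψ : ℚ_p → S¹` of conductor exponent `0`, every `w ∣ v` and every star on `K_w`
preserving integrality: `(∀ y ∈ 𝒪_w^{ι × κ}, ψ_w(⟨x, y⟩_{M_V ⊗ₖ M_W}) = 1) ⟺ x ∈ 𝒪_w^{ι × κ}`, with
`ψ_w = ψ ∘ Tr_{K⁺_v/ℚ_p} ∘ Tr_{K_w/K⁺_v}` (files 329 / 331). -/
theorem forall_recordChar_kronecker_iff_mem_stdLattice
    (h : ((discr K : ℤ) : 𝓞 (maximalRealSubfield K)) ∉ v.asIdeal)
    (ψ : AddChar (vp.adicCompletion ℚ) Circle) (hψ : Continuous ψ) (hne : ∃ y, ψ y ≠ 1)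
    (h0 : conductorExp ψ (Valued.v : Valuation (vp.adicCompletion ℚ) (WithZero (Multiplicative ℤ))) = 0)
    [StarRing (w.adicCompletion K)]
    (hstar : ∀ z : w.adicCompletion K, IsLocalization.IsInteger (w.adicCompletionIntegers K) z →
      IsLocalization.IsInteger (w.adicCompletionIntegers K) (star z))
    (x : ι × κ → w.adicCompletion K) :
    (∀ y ∈ stdLattice (w.adicCompletionIntegers K),
      recordChar K vp v w ψ
        (sesqForm (((algebraMap (𝓞 K) K).mapMatrix MV ⊗ₖ (algebraMap (𝓞 K) K).mapMatrix MW).map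
          (algebraMap K (w.adicCompletion K))) x y) = 1) ↔
      x ∈ stdLattice (w.adicCompletionIntegers K) :=
  forall_addChar_kronecker_iff_mem_stdLattice w (recordChar K vp v w ψ) (continuous_recordChar K vp v w ψ hψ)
    (exists_recordChar_ne_one K vp v w ψ hne) (conductorExp_recordChar_eq_zero K vp v w h ψ hψ hne h0) hstar
    (isUnit_det_mapMatrix MV hV) (isUnit_det_mapMatrix MW hW) (notMem_badSet_mapMatrix MV hV w)
    (notMem_badSet_mapMatrix MW hW w) x

end Record

end Summit.Ventures.HodgeRepro2.T5DualPairLatticeKronecker
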